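/-
Origin: expansion seat `planner-pub-hodgecm-carver-0`, handover 2026-08-18T03:27:49Z (synced 03:34:05Z) (`HOME/pub-hodgecm-carver/lean/Carver/PerL34/Allowed.lean`, md5 d606dce7, 67 lines);
landed by the gen-5 packager in gate run 18 as `HodgeCM/PerL34/Allowed.lean` (verbatim).
-/
/-
Origin: HOME/pub-hodgecm-carver/lean/HodgeCM/PerL34/Allowed.lean — session planner-pub-hodgecm-carver-0 (unit
pub-hodgecm-carver, THE CARVER).  Intended final place: `HodgeCM/PerL34/Allowed.lean`.
DAG nodes (HOME/LEMMAS.md §1): N11 (Def 3.2), N12 (Lemma 3.3(a)), N13 (Lemma 3.3(b)), N14 (§3.2 lines paragraph,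
Landherr), N15 (§3.2 splitting characters), N16 (T, T′, χ₁₂, χ₃₄).  Nothing is asserted.
-/
import Summits.HodgeConjecture.HodgeCM.Proofs.LandherrClassification
import Summits.HodgeConjecture.HodgeCM.Automorphic.ThetaFacts

set_option autoImplicit false

/-!
# PerL v5 §3.2 — theta data and the seesaw plane (DAG nodes N11–N16)

* **N11** (Def 3.2 `def:allowed`, tex ll. 269–279): allowed data `(W_i, μ_i, χ'_i)` / allowed pairs with
  `μ₁μ₂ = μ₃μ₄ = μ_W`.  In the package: the predicate `Perl34.TorusData.allowed` of the model's torus sides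
  `T.t12 V c`, `T.t34 V c` (lines and splitting characters FIXED, ll. 277–278) and the context predicate
  `ThetaModel.GoodCtx` (forced signs).  DEFINITIONAL (posited data); no statement.
* **N12** (Lemma 3.3(a), ll. 281–284) — typed below as `N12a_thetaSub` (the typing of theta one-forms, = the
  model fact `Open_thetaSub`, INTERNAL: PerL L3.3(a) + Prop 2.3 + [Y1neg] Thm 8.1(a)) and `N12b_signRecipe`
  (the forced-sign rule "`s_b(W_i)=m^{-1}(m_b(\Psi_i))` for `b\ne\iota_1` and `s_{\iota_1}(W_i)=\varepsilon_{\rm hol}`"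
  abstracted as the two equivariances `Design_kappaConj`, `Design_frameSignConj`).
* **N13** (Lemma 3.3(b), ll. 284–286): PROVED in the package — `HodgeCM.Universe.ThetaModel.reqPos_pairSum`
  (Proofs/RealisationConstruction) and `HodgeCM.lemma33b_signs` (CM/Lemmas); nothing to do.
* **N14** (ll. 299–304, Landherr): typed below as `N14_landherr := HodgeCM.Lemma33bLandherr`; PROVED in the
  package from the PRINT input `HasseMinkowskiQuinary` (`lemma33bLandherr_of_hasseMinkowski`, run 14) — re-exported.
* **N15** (ll. 304–314, existence of the splitting characters `μ_i`): NOT typeable today — the package has no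
  Hecke-character vocabulary (LEMMAS.md §3 D3); the `μ_i` are DATA of the model's torus sides.
* **N16** (ll. 314–317): definitions `T, T', χ_{12}, χ_{34}, P_{T,χ}` = data of `Perl34.TorusData`.
-/

namespace HodgeCM
namespace PerL34

variable {U : Universe} (T : U.ThetaModel)

/-- **N12a** (PerL v5 Lemma 3.3(a), tex ll. 281–283): "If `(W_i,\mu_i,\chi'_i)` is allowed of type `\Psi_i` then
every irreducible constituent `\sigma` of the closure of `\pi_i` has `\Phi'(\sigma)=\Psi_i` (so the holomorphic
`1`-forms attached to vectors of `\pi_i[\fp_+]` lie in `U_{t^i}`, Proposition~\ref{prop:dict})".  Typed as the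
consumed consequence: theta one-forms of type `Ψ_i` lie in `U_{Ψ_i}` (`Universe.Uiso`).  INTERNAL. -/
def N12a_thetaSub : Prop := T.Open_thetaSub

/-- **N12b** (PerL v5 Lemma 3.3(a), tex ll. 283–284): "the real signs of `W_i` are forced:
`s_b(W_i)=m^{-1}(m_b(\Psi_i))` for `b\ne\iota_1` and `s_{\iota_1}(W_i)=\varepsilon_{\rm hol}`, in the notation of
\cite[Lemmas~3.1, 3.2]{Y1neg}" — abstracted in the model as the sign recipe (`kappa`, `frameSign`) with its two
conjugation equivariances.  DESIGN (definitional constraint on the model's own sign data; (eq:Psit) ll. 61–64). -/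
def N12b_signRecipe : Prop := T.Design_kappaConj ∧ T.Design_frameSignConj

/-- (Ported verbatim from the HodgeCMPerL package; no docstring in the source.) -/
theorem N12a_iff : N12a_thetaSub T ↔ T.Open_thetaSub := Iff.rfl
/-- (Ported verbatim from the HodgeCMPerL package; no docstring in the source.) -/
theorem N12b_iff : N12b_signRecipe T ↔ T.Design_kappaConj ∧ T.Design_frameSignConj := Iff.rfl

/-- **N14** (PerL v5 §3.2, tex ll. 299–300): "By Lemma~\ref{lem:allowed}(b) and Landherr's theorem (hermitian
spaces over `L/L_0` are classified by dimension, determinant in `L_0^\times/N(L^\times)` and signatures) we may and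
do choose the lines so that `W_1\oplus W_2\cong W_3\oplus W_4`".  Typed as the package's named target
`HodgeCM.Lemma33bLandherr` (the classification half actually consumed by the construction
`ThetaModel.exists_seesawDatum`). -/
def N14_landherr : Prop := Lemma33bLandherr

/-- (Ported verbatim from the HodgeCMPerL package; no docstring in the source.) -/
theorem N14_iff : N14_landherr ↔ Lemma33bLandherr := Iff.rfl

/-- N14 from the input Hasse–Minkowski (quinary forms over number fields, O'Meara 66:1 — itself a THEOREM of
the package since run 22): re-export of `HodgeCM.lemma33bLandherr_of_hasseMinkowski` (Proofs/LandherrClassification,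
run 14).  N14 holds OUTRIGHT since run 22: `HodgeCM.lemma33bLandherr_holds` (re-exported as `N14_landherr_holds`,
Proofs/LandherrDischarge). -/
theorem N14_of_hasseMinkowski (h : HasseMinkowskiQuinary) : N14_landherr :=
  lemma33bLandherr_of_hasseMinkowski h

end PerL34
end HodgeCM
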